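import Mathlib

/-!
# Unique `n`-th roots in a finite field when `gcd(n, q - 1) = 1`

The algebra behind §7.11 (16.5)(b)(i) of the solo-informed paper: if `𝔮` is a prime of `F` with
`N𝔮 ≢ 1 (mod p)`, then `x ↦ x ^ p` is a bijection of the residue field `k(𝔮)`, so `X ^ p - η̄` has
exactly one root in `k(𝔮)` and the Kummer extension `F(η^{1/p}) / F` has exactly one prime of relative
degree one above `𝔮`.  We record the finite-field statement: for a finite field `K` and `n` coprime to
`card K - 1`, every element of `K` has exactly one `n`-th root (and the `n`-th power map is a bijection).
-/

namespace Summit.Langlands.Langlands.Theorems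

open Function

/-- In a finite field `K` with `gcd(card K - 1, n) = 1`, the `n`-th power map on units is bijective. -/
theorem soloInformed_units_pow_bijective (K : Type*) [Field K] [Fintype K] {n : ℕ}
    (h : (Fintype.card K - 1).Coprime n) : Bijective (fun u : Kˣ => u ^ n) := by
  classical
  have hc : (Nat.card Kˣ).Coprime n := by
    rwa [Nat.card_eq_fintype_card, Fintype.card_units]
  exact Nat.Coprime.pow_left_bijective hc

/-- In a finite field `K` with `gcd(card K - 1, n) = 1` and `0 < n`, the `n`-th power map on `K` is
bijective. -/
theorem soloInformed_pow_bijective (K : Type*) [Field K] [Fintype K] {n : ℕ} (hn : 0 < n)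
    (h : (Fintype.card K - 1).Coprime n) : Bijective (fun x : K => x ^ n) := by
  classical
  have hu := soloInformed_units_pow_bijective K h
  constructor
  · intro x y hxy
    simp only at hxy
    by_cases hx : x = 0
    · subst hx
      rw [zero_pow hn.ne'] at hxy
      exact ((pow_eq_zero_iff hn.ne').mp hxy.symm).symm
    · have hy : y ≠ 0 := by
        intro hy; subst hy
        rw [zero_pow hn.ne'] at hxy
        exact hx ((pow_eq_zero_iff hn.ne').mp hxy)
      have : Units.mk0 x hx ^ n = Units.mk0 y hy ^ n := by
        ext; simp [Units.val_pow_eq_pow_val, hxy]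
      have := hu.1 this
      simpa [Units.ext_iff] using this
  · intro a
    by_cases ha : a = 0
    · exact ⟨0, by simp [ha, zero_pow hn.ne']⟩
    · obtain ⟨u, hu'⟩ := hu.2 (Units.mk0 a ha)
      refine ⟨(u : K), ?_⟩
      have := congrArg (fun v : Kˣ => (v : K)) hu'
      simpa [Units.val_pow_eq_pow_val] using this

/-- In a finite field `K` with `gcd(card K - 1, n) = 1` and `0 < n`, every element has exactly one
`n`-th root: `X ^ n - a` has exactly one root in `K`. -/
theorem soloInformed_existsUnique_pow_eq (K : Type*) [Field K] [Fintype K] {n : ℕ} (hn : 0 < n)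
    (h : (Fintype.card K - 1).Coprime n) (a : K) : ∃! x : K, x ^ n = a := by
  obtain ⟨x, hx⟩ := (soloInformed_pow_bijective K hn h).2 a
  exact ⟨x, hx, fun y hy => (soloInformed_pow_bijective K hn h).1 (hy.trans hx.symm)⟩

end Summit.Langlands.Langlands.Theorems
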